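import Literature.Combinatorics.Optimization.MatchingFunctionDegree
import HarnessLib

/-!
# Functions on perfect matchings depending on few vertices have low degree

Godsil–Meagher, *Erdős–Ko–Rado Theorems: Algebraic Approaches* (CUP 2015), Ch. 15 (the perfect
matching scheme), and Lindzey, *Erdős–Ko–Rado for perfect matchings* (Eur. J. Combin. 65 (2017)),
§§2–3: the space of functions on the perfect matchings of `K_{2m}` is filtered by degree, the
degree-`≤ k` part being spanned by the indicators `x_Q(M) = [Q ⊆ M]` of partial matchings with
`|Q| ≤ k`; a function depending only on the edges inside a set `B` of `≤ 2k` vertices (a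
"`B`-junta") has degree `≤ k`, because the indicator of "`M ∩ E(B) = Q`" expands by
inclusion–exclusion into `±x_{Q ∪ R}` with `Q ∪ R ⊆ E(B)`, and `x_T = 0` on perfect matchings
unless `T` is a matching (then `|T| ≤ |B|/2 ≤ k`).  We also record the relative transitivity of
`𝔖ₙ` on perfect matchings: two perfect matchings with the same edges inside `B` differ by a
permutation fixing `B` pointwise (composition of transpositions outside `B`), so functions
invariant under the pointwise stabiliser of `B` are `B`-juntas.

* `innerEdges B`, `mem_polLE_of_junta`;
* `PMSol.partner` and its calculus; `exists_perm_fix_smul_eq` (relative transitivity);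
* `mem_polLE_of_invariant`.

Used for the crux `InvariantSubspaceLowDegree` of the rung route `EquivariantThetaLift` (cell
pnp-psdrank): push-forwards of `2k`-coset indicators of `𝔖ₙ` are invariant under the pointwise
stabiliser of the `2k` target points.

## References

* C. Godsil, K. Meagher, *Erdős–Ko–Rado Theorems: Algebraic Approaches*, Cambridge Univ. Press
  2015, Ch. 15 (§15.2–15.5: perfect matchings, the matching module and its filtration). [GodsilMeagher2015]
* G. Braun et al., *The matching problem has no small symmetric SDP*, Math. Program. 165 (2017),
  §4.1–4.3 (functions on perfect matchings as `ℝ[x]/⟨𝒫_n⟩`, monomials `x_M`). [BraunEtAl2016]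
-/

noncomputable section

open Finset
open Literature.Barriers.PneNP (IsPMOn)

namespace Literature.Combinatorics.Optimization

variable {n : ℕ}

/-! ### Pairs inside a vertex set -/

/-- The pairs with both members in `B`. [cite: GodsilMeagher2015, §15.2] -/
def innerEdges (B : Finset (Fin n)) : Finset (Sym2 (Fin n)) :=
  univ.filter fun e : Sym2 (Fin n) => ∀ v ∈ e, v ∈ B

/-- Membership. [cite: GodsilMeagher2015, §15.2] -/
theorem mem_innerEdges {B : Finset (Fin n)} {e : Sym2 (Fin n)} : e ∈ innerEdges B ↔ ∀ v ∈ e, v ∈ B := by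
  simp [innerEdges]

/-! ### Monomial functions of large pair sets inside a small vertex set vanish -/

/-- A pair set inside `B` contained in a perfect matching has at most `|B|/2` pairs.
[cite: GodsilMeagher2015, §15.2] -/
theorem two_mul_card_le_of_subset {B : Finset (Fin n)} {T : Finset (Sym2 (Fin n))}
    (hT : T ⊆ innerEdges B) (M : PMSol n) (hTM : T ⊆ M.1) : 2 * T.card ≤ B.card := by
  classical
  -- double count the incidences between `B` and `T`
  have h1 : ∀ e ∈ T, (B.filter fun v => v ∈ e).card = 2 := by
    intro e he
    have hnd : ¬ e.IsDiag := M.2.2.1 e (hTM he)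
    have hB := mem_innerEdges.1 (hT he)
    induction e using Sym2.ind with
    | _ x y =>
      have hxy : x ≠ y := fun h => hnd (Sym2.mk_isDiag_iff.2 h)
      have : B.filter (fun v => v ∈ s(x, y)) = {x, y} := by
        ext v
        simp only [mem_filter, Sym2.mem_iff, mem_insert, mem_singleton]
        constructor
        · exact fun h => h.2
        · rintro (rfl | rfl)
          · exact ⟨hB _ (Sym2.mem_mk_left _ _), Or.inl rfl⟩
          · exact ⟨hB _ (Sym2.mem_mk_right _ _), Or.inr rfl⟩
      rw [this, card_pair hxy]
  have h2 : ∀ v ∈ B, (T.filter fun e => v ∈ e).card ≤ 1 := by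
    intro v _
    rw [← M.2.2.2 v (mem_univ v)]
    exact card_le_card (filter_subset_filter _ hTM)
  have key : ∑ e ∈ T, (B.filter fun v => v ∈ e).card = ∑ v ∈ B, (T.filter fun e => v ∈ e).card := by
    simp only [card_eq_sum_ones, sum_filter]
    exact sum_comm
  calc 2 * T.card = ∑ e ∈ T, 2 := by rw [sum_const, smul_eq_mul, mul_comm]
    _ = ∑ e ∈ T, (B.filter fun v => v ∈ e).card := (sum_congr rfl h1).symm
    _ = ∑ v ∈ B, (T.filter fun e => v ∈ e).card := key
    _ ≤ ∑ v ∈ B, 1 := sum_le_sum h2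
    _ = B.card := by rw [sum_const, smul_eq_mul, mul_one]

/-- `x_T = 0` on perfect matchings if `T ⊆ E(B)` has more than `|B|/2` pairs.
[cite: GodsilMeagher2015, §15.2] [cite: BraunEtAl2016, Lemma 4.4 (monomials off partial matchings vanish)] -/
theorem monomialFn_eq_zero_of_card_lt {B : Finset (Fin n)} {T : Finset (Sym2 (Fin n))}
    (hT : T ⊆ innerEdges B) (hcard : B.card < 2 * T.card) : monomialFn T = 0 := by
  funext M
  rw [monomialFn_apply, if_neg]
  · rfl
  · exact fun h => absurd (two_mul_card_le_of_subset hT M h) (not_le.2 hcard)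

/-- `x_T ∈ Pol_{≤k}` for every `T ⊆ E(B)`, `|B| ≤ 2k`. [cite: GodsilMeagher2015, §15.5] -/
theorem monomialFn_mem_polLE_of_subset {B : Finset (Fin n)} {k : ℕ} (hB : B.card ≤ 2 * k)
    {T : Finset (Sym2 (Fin n))} (hT : T ⊆ innerEdges B) : monomialFn T ∈ polLE n k := by
  by_cases h : T.card ≤ k
  · exact Submodule.subset_span ⟨T, h, rfl⟩
  · rw [monomialFn_eq_zero_of_card_lt hT (by omega)]
    exact Submodule.zero_mem _

/-! ### Juntas -/

/-- The indicator of "`M ∩ E(B) = Q`". [cite: GodsilMeagher2015, §15.5] -/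
def interIndicator (B : Finset (Fin n)) (Q : Finset (Sym2 (Fin n))) : PMSol n → ℝ :=
  fun M => if M.1 ∩ innerEdges B = Q then 1 else 0

/-- **Inclusion–exclusion**: `[M ∩ E(B) = Q] = Σ_{R ⊆ E(B) ∖ Q} (-1)^{|R|} x_{Q ∪ R}(M)` for
`Q ⊆ E(B)`. [cite: GodsilMeagher2015, §15.5] -/
theorem interIndicator_eq_sum (B : Finset (Fin n)) {Q : Finset (Sym2 (Fin n))} (hQ : Q ⊆ innerEdges B) :
    interIndicator B Q =
      ∑ R ∈ (innerEdges B \ Q).powerset, ((-1 : ℝ) ^ R.card) • monomialFn (Q ∪ R) := by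
  classical
  funext M
  set E := innerEdges B with hE
  -- `[M ∩ E = Q] = [Q ⊆ M] · Π_{e ∈ E \ Q} (1 - [e ∈ M])`
  have hprod : interIndicator B Q M =
      (if Q ⊆ M.1 then (1 : ℝ) else 0) * ∏ e ∈ E \ Q, (1 - if e ∈ M.1 then (1 : ℝ) else 0) := by
    rw [interIndicator]
    by_cases hMQ : M.1 ∩ E = Q
    · rw [if_pos hMQ, if_pos (show Q ⊆ M.1 from fun q hq => (mem_inter.1 (hMQ.symm ▸ hq : q ∈ M.1 ∩ E)).1)]
      rw [one_mul, eq_comm]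
      refine prod_eq_one fun e he => ?_
      obtain ⟨heE, heQ⟩ := mem_sdiff.1 he
      rw [if_neg (fun heM => heQ (hMQ ▸ mem_inter.2 ⟨heM, heE⟩)), sub_zero]
    · rw [if_neg hMQ]
      by_cases hQM : Q ⊆ M.1
      · -- some `e ∈ (M ∩ E) \ Q` kills the product
        have : ∃ e ∈ E \ Q, e ∈ M.1 := by
          by_contra hne
          push Not at hne
          apply hMQ
          ext e
          rw [mem_inter]
          constructor
          · rintro ⟨heM, heE⟩
            by_contra heQ
            exact hne e (mem_sdiff.2 ⟨heE, heQ⟩) heM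
          · exact fun heQ => ⟨hQM heQ, hQ heQ⟩
        obtain ⟨e, he, heM⟩ := this
        rw [if_pos hQM, one_mul, eq_comm]
        exact prod_eq_zero he (by rw [if_pos heM, sub_self])
      · rw [if_neg hQM, zero_mul]
  rw [hprod, Finset.sum_apply]
  -- expand the product
  have hexp : ∏ e ∈ E \ Q, (1 - if e ∈ M.1 then (1 : ℝ) else 0) =
      ∑ R ∈ (E \ Q).powerset, (-1 : ℝ) ^ R.card * ∏ e ∈ R, (if e ∈ M.1 then (1 : ℝ) else 0) := by
    have : ∀ e ∈ E \ Q, (1 - if e ∈ M.1 then (1 : ℝ) else 0) =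
        (-(if e ∈ M.1 then (1 : ℝ) else 0)) + 1 := fun e _ => by ring
    rw [prod_congr rfl this, prod_add]
    refine sum_congr rfl fun R _ => ?_
    rw [prod_const_one, mul_one, prod_neg]
  rw [hexp, mul_sum]
  refine sum_congr rfl fun R hR => ?_
  rw [Pi.smul_apply, smul_eq_mul, monomialFn_apply]
  have hRsub : R ⊆ E \ Q := mem_powerset.1 hR
  -- `[Q ⊆ M] · Π_{e ∈ R} [e ∈ M] = [Q ∪ R ⊆ M]`
  have hind : (if Q ⊆ M.1 then (1 : ℝ) else 0) * ∏ e ∈ R, (if e ∈ M.1 then (1 : ℝ) else 0) =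
      if Q ∪ R ⊆ M.1 then 1 else 0 := by
    by_cases hQM : Q ⊆ M.1
    · rw [if_pos hQM, one_mul]
      by_cases hRM : R ⊆ M.1
      · rw [if_pos (union_subset hQM hRM)]
        exact prod_eq_one fun e he => if_pos (hRM he)
      · rw [if_neg (fun h => hRM ((subset_union_right).trans h))]
        obtain ⟨e, heR, heM⟩ := not_subset.1 hRM
        exact prod_eq_zero heR (if_neg heM)
    · rw [if_neg hQM, zero_mul, if_neg (fun h => hQM ((subset_union_left).trans h))]
  rw [mul_left_comm, hind]

/-- The indicator `[M ∩ E(B) = Q]` has degree `≤ k` for `|B| ≤ 2k`. [cite: GodsilMeagher2015, §15.5] -/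
theorem interIndicator_mem_polLE (B : Finset (Fin n)) {k : ℕ} (hB : B.card ≤ 2 * k)
    (Q : Finset (Sym2 (Fin n))) : interIndicator B Q ∈ polLE n k := by
  classical
  by_cases hQ : Q ⊆ innerEdges B
  · rw [interIndicator_eq_sum B hQ]
    refine Submodule.sum_mem _ fun R hR => Submodule.smul_mem _ _ ?_
    refine monomialFn_mem_polLE_of_subset hB (union_subset hQ ?_)
    exact (mem_powerset.1 hR).trans sdiff_subset
  · have : interIndicator B Q = 0 := by
      funext M
      rw [interIndicator, if_neg (fun h : M.1 ∩ innerEdges B = Q => hQ (h ▸ inter_subset_right))]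
      rfl
    rw [this]
    exact Submodule.zero_mem _

/-- **Juntas have low degree**: a function on perfect matchings depending only on the edges
inside a set `B` of at most `2k` vertices lies in `Pol_{≤k}`. [cite: GodsilMeagher2015, §15.5] -/
theorem mem_polLE_of_junta (B : Finset (Fin n)) {k : ℕ} (hB : B.card ≤ 2 * k) (g : PMSol n → ℝ)
    (hg : ∀ M M' : PMSol n, M.1 ∩ innerEdges B = M'.1 ∩ innerEdges B → g M = g M') :
    g ∈ polLE n k := by
  classical
  -- `g = Σ_Q G(Q) [M ∩ E(B) = Q]`
  let G : Finset (Sym2 (Fin n)) → ℝ := fun Q =>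
    if h : ∃ M : PMSol n, M.1 ∩ innerEdges B = Q then g h.choose else 0
  have hgG : ∀ M : PMSol n, g M = G (M.1 ∩ innerEdges B) := by
    intro M
    have h : ∃ M' : PMSol n, M'.1 ∩ innerEdges B = M.1 ∩ innerEdges B := ⟨M, rfl⟩
    change g M = dite _ _ _
    rw [dif_pos h]
    exact hg M h.choose h.choose_spec.symm
  have hsum : g = ∑ Q ∈ (innerEdges B).powerset, G Q • interIndicator B Q := by
    funext M
    rw [Finset.sum_apply, Finset.sum_eq_single (M.1 ∩ innerEdges B)]
    · rw [Pi.smul_apply, interIndicator, if_pos rfl, smul_eq_mul, mul_one, hgG]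
    · intro Q _ hQ
      rw [Pi.smul_apply, interIndicator, if_neg (Ne.symm hQ), smul_zero]
    · intro h
      exact absurd (mem_powerset.2 inter_subset_right) h
  rw [hsum]
  exact Submodule.sum_mem _ fun Q _ => Submodule.smul_mem _ _ (interIndicator_mem_polLE B hB Q)

/-! ### Partners in a perfect matching -/

namespace PMSol

variable (M : PMSol n) (v : Fin n)

/-- The unique edge of `M` at `v`. [cite: GodsilMeagher2015, §15.2] -/
theorem existsUnique_edge : ∃! e, e ∈ M.1 ∧ v ∈ e := by
  classical
  have h := M.2.2.2 v (mem_univ v)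
  obtain ⟨e, he⟩ := card_eq_one.1 h
  have hmem : e ∈ M.1.filter fun e => v ∈ e := by rw [he]; exact mem_singleton_self e
  refine ⟨e, ⟨(mem_filter.1 hmem).1, (mem_filter.1 hmem).2⟩, fun e' he' => ?_⟩
  have : e' ∈ M.1.filter fun e => v ∈ e := mem_filter.2 he'
  rw [he] at this
  exact mem_singleton.1 this

/-- The edge of `M` at `v`. [cite: GodsilMeagher2015, §15.2] -/
def edgeAt : Sym2 (Fin n) := by
  classical exact Finset.choose (fun e => v ∈ e) M.1 (existsUnique_edge M v)

/-- `edgeAt M v ∈ M`. [cite: GodsilMeagher2015, §15.2] -/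
theorem edgeAt_mem : edgeAt M v ∈ M.1 := by
  classical exact Finset.choose_mem _ _ _

/-- `v ∈ edgeAt M v`. [cite: GodsilMeagher2015, §15.2] -/
theorem mem_edgeAt : v ∈ edgeAt M v := by
  classical exact Finset.choose_property (fun e => v ∈ e) M.1 (existsUnique_edge M v)

variable {M v} in
/-- Uniqueness of the edge at `v`. [cite: GodsilMeagher2015, §15.2] -/
theorem eq_edgeAt {e : Sym2 (Fin n)} (he : e ∈ M.1) (hv : v ∈ e) : e = edgeAt M v :=
  (existsUnique_edge M v).unique ⟨he, hv⟩ ⟨edgeAt_mem M v, mem_edgeAt M v⟩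

/-- **The partner** of `v` in `M`. [cite: GodsilMeagher2015, §15.2] -/
def partner : Fin n := Sym2.Mem.other (mem_edgeAt M v)

/-- `edgeAt M v = {v, partner}`. [cite: GodsilMeagher2015, §15.2] -/
theorem edgeAt_eq : edgeAt M v = s(v, partner M v) := (Sym2.other_spec (mem_edgeAt M v)).symm

/-- `{v, partner M v} ∈ M`. [cite: GodsilMeagher2015, §15.2] -/
theorem mk_partner_mem : s(v, partner M v) ∈ M.1 := by rw [← edgeAt_eq]; exact edgeAt_mem M v

/-- `partner M v ≠ v`. [cite: GodsilMeagher2015, §15.2] -/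
theorem partner_ne : partner M v ≠ v :=
  Sym2.other_ne (M.2.2.1 _ (edgeAt_mem M v)) (mem_edgeAt M v)

variable {M v} in
/-- `{v, w} ∈ M ↔ w = partner M v`. [cite: GodsilMeagher2015, §15.2] -/
theorem mk_mem_iff {w : Fin n} : s(v, w) ∈ M.1 ↔ w = partner M v := by
  constructor
  · intro h
    have := eq_edgeAt h (Sym2.mem_mk_left v w)
    rw [edgeAt_eq] at this
    exact Sym2.congr_right.1 this
  · rintro rfl; exact mk_partner_mem M v

/-- `partner` is an involution. [cite: GodsilMeagher2015, §15.2] -/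
theorem partner_partner : partner M (partner M v) = v := by
  symm
  rw [← mk_mem_iff, Sym2.eq_swap]
  exact mk_partner_mem M v

variable {M} in
/-- Perfect matchings are determined by their partner functions. [cite: GodsilMeagher2015, §15.2] -/
theorem ext_of_partner {M' : PMSol n} (h : ∀ v, partner M v = partner M' v) : M = M' := by
  apply Subtype.ext
  ext e
  induction e using Sym2.ind with
  | _ x y => rw [mk_mem_iff, mk_mem_iff, h]

/-- The action on edge sets, unfolded on members. [cite: BraunEtAl2016, §4.1 (p. 8)] -/
theorem mem_smul_iff (π : Equiv.Perm (Fin n)) (e : Sym2 (Fin n)) :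
    e ∈ (π • M).1 ↔ Sym2.map ⇑π⁻¹ e ∈ M.1 := by
  rw [PMSol.smul_val, mem_image]
  constructor
  · rintro ⟨e', he', rfl⟩
    rw [Sym2.map_map]
    have : (⇑π⁻¹ ∘ ⇑π) = id := by funext x; simp
    rw [this, Sym2.map_id, id]
    exact he'
  · intro h
    refine ⟨_, h, ?_⟩
    rw [Sym2.map_map]
    have : (⇑π ∘ ⇑π⁻¹) = id := by funext x; simp
    rw [this, Sym2.map_id, id]

end PMSol

/-! ### Relative transitivity -/

open PMSol in
/-- **Relative transitivity of `𝔖ₙ` on perfect matchings**: two perfect matchings with the same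
edges inside `B` differ by a permutation fixing `B` pointwise.
[cite: GodsilMeagher2015, §15.2 (the perfect matching scheme is an orbital scheme of `S_{2m}`)] -/
theorem exists_perm_fix_smul_eq (B : Finset (Fin n)) (M' : PMSol n) :
    ∀ M : PMSol n, M.1 ∩ innerEdges B = M'.1 ∩ innerEdges B →
      ∃ π : Equiv.Perm (Fin n), (∀ b ∈ B, π b = b) ∧ π • M = M' := by
  classical
  intro M
  obtain ⟨N, hN⟩ : ∃ N, (M'.1 \ M.1).card = N := ⟨_, rfl⟩
  induction N using Nat.strong_induction_on generalizing M with
  | _ N ih =>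
  intro hE
  by_cases heq : ∀ v, partner M v = partner M' v
  · exact ⟨1, fun b _ => rfl, by rw [one_smul]; exact ext_of_partner heq⟩
  push Not at heq
  -- choose the pivot vertex: in `B` if some vertex of `B` disagrees
  have hpiv : ∃ v, partner M v ≠ partner M' v ∧ partner M v ∉ B ∧ partner M' v ∉ B := by
    -- agreement inside `B` transfers edges inside `B`
    have hin : ∀ b ∈ B, ∀ w ∈ B, (s(b, w) ∈ M.1 ↔ s(b, w) ∈ M'.1) := by
      intro b hb w hw
      have hbw : s(b, w) ∈ innerEdges B := mem_innerEdges.2 fun v hv => by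
        rcases Sym2.mem_iff.1 hv with rfl | rfl <;> assumption
      constructor
      · intro h
        exact (mem_inter.1 (hE ▸ mem_inter.2 ⟨h, hbw⟩ : s(b, w) ∈ M'.1 ∩ innerEdges B)).1
      · intro h
        exact (mem_inter.1 (hE.symm ▸ mem_inter.2 ⟨h, hbw⟩ : s(b, w) ∈ M.1 ∩ innerEdges B)).1
    by_cases hB : ∃ b ∈ B, partner M b ≠ partner M' b
    · obtain ⟨b, hb, hne⟩ := hB
      refine ⟨b, hne, fun hp => hne ?_, fun hp' => hne ?_⟩
      · have h := (hin b hb _ hp).1 (mk_partner_mem M b)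
        exact mk_mem_iff.1 h
      · have h := (hin b hb _ hp').2 (mk_partner_mem M' b)
        exact (mk_mem_iff.1 h).symm
    · push Not at hB
      obtain ⟨v, hv⟩ := heq
      refine ⟨v, hv, fun hp => hv ?_, fun hp' => hv ?_⟩
      · -- `partner M v ∈ B` agrees, so `partner M' (partner M v) = v`
        have h1 := hB _ hp
        rw [partner_partner] at h1
        have h2 : s(partner M v, v) ∈ M'.1 := by rw [mk_mem_iff]; exact h1
        rw [Sym2.eq_swap, mk_mem_iff] at h2
        exact h2
      · have h1 := (hB _ hp').symm
        rw [partner_partner] at h1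
        have h2 : s(partner M' v, v) ∈ M.1 := by rw [mk_mem_iff]; exact h1
        rw [Sym2.eq_swap, mk_mem_iff] at h2
        exact h2.symm
  obtain ⟨v, hv, hpB, hp'B⟩ := hpiv
  set p := partner M v with hp
  set p' := partner M' v with hp'
  set τ := Equiv.swap p p' with hτ
  have hτB : ∀ b ∈ B, τ b = b := fun b hb =>
    Equiv.swap_apply_of_ne_of_ne (fun h => hpB (h ▸ hb)) (fun h => hp'B (h ▸ hb))
  have hτv : τ v = v :=
    Equiv.swap_apply_of_ne_of_ne (partner_ne M v).symm (partner_ne M' v).symm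
  -- the new matching `τ • M`
  set M₁ := τ • M with hM₁
  -- edges of `M ∩ M'` avoid `p` and `p'`, hence survive
  have hsurv : ∀ e ∈ M.1, e ∈ M'.1 → e ∈ M₁.1 := by
    intro e he he'
    rw [hM₁, mem_smul_iff, Equiv.swap_inv]
    have hpe : p ∉ e := by
      intro hpe
      have : e = s(p, v) := by
        rw [eq_edgeAt he hpe, edgeAt_eq, hp, partner_partner]
      rw [this, Sym2.eq_swap, mk_mem_iff] at he'
      exact hv he'
    have hp'e : p' ∉ e := by
      intro hp'e
      have : e = s(p', v) := by
        rw [eq_edgeAt he' hp'e, edgeAt_eq, hp', partner_partner]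
      rw [this, Sym2.eq_swap, mk_mem_iff] at he
      exact hv he.symm
    have hfix : Sym2.map (Equiv.swap p p') e = e := by
      induction e using Sym2.ind with
      | _ x y =>
        rw [Sym2.map_mk, Equiv.swap_apply_of_ne_of_ne, Equiv.swap_apply_of_ne_of_ne]
        · exact fun h => hpe (h ▸ Sym2.mem_mk_right x y)
        · exact fun h => hp'e (h ▸ Sym2.mem_mk_right x y)
        · exact fun h => hpe (h ▸ Sym2.mem_mk_left x y)
        · exact fun h => hp'e (h ▸ Sym2.mem_mk_left x y)
    rw [hfix]; exact he
  -- the new common edge `{v, p'}`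
  have hnew : s(v, p') ∈ M₁.1 := by
    rw [hM₁, mem_smul_iff, Equiv.swap_inv, Sym2.map_mk, hτv, Equiv.swap_apply_right]
    exact mk_partner_mem M v
  have hnew' : s(v, p') ∈ M'.1 := mk_partner_mem M' v
  have hold : s(v, p') ∉ M.1 := fun h => hv (mk_mem_iff.1 h).symm
  -- the measure drops
  have hlt : (M'.1 \ M₁.1).card < N := by
    rw [← hN]
    refine card_lt_card ⟨fun e he => ?_, fun hsub => ?_⟩
    · obtain ⟨he', he₁⟩ := mem_sdiff.1 he
      exact mem_sdiff.2 ⟨he', fun heM => he₁ (hsurv e heM he')⟩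
    · have := mem_sdiff.1 (hsub (mem_sdiff.2 ⟨hnew', hold⟩))
      exact this.2 hnew
  -- the hypothesis is preserved
  have hE₁ : M₁.1 ∩ innerEdges B = M'.1 ∩ innerEdges B := by
    rw [← hE]
    ext e
    simp only [mem_inter]
    refine and_congr_left fun heB => ?_
    rw [hM₁, mem_smul_iff, Equiv.swap_inv]
    have hfix : Sym2.map (Equiv.swap p p') e = e := by
      have hB' := mem_innerEdges.1 heB
      induction e using Sym2.ind with
      | _ x y => rw [Sym2.map_mk, hτB x (hB' x (Sym2.mem_mk_left x y)), hτB y (hB' y (Sym2.mem_mk_right x y))]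
    rw [hfix]
  obtain ⟨π₁, hπ₁B, hπ₁⟩ := ih _ hlt M₁ rfl hE₁
  refine ⟨π₁ * τ, fun b hb => ?_, ?_⟩
  · rw [Equiv.Perm.mul_apply, hτB b hb, hπ₁B b hb]
  · rw [mul_smul]; exact hπ₁

/-- **Invariant functions are juntas**: a function on perfect matchings invariant under every
permutation fixing `B` pointwise, `|B| ≤ 2k`, lies in `Pol_{≤k}`. [cite: GodsilMeagher2015, §15.5] -/
theorem mem_polLE_of_invariant (B : Finset (Fin n)) {k : ℕ} (hB : B.card ≤ 2 * k) (g : PMSol n → ℝ)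
    (hg : ∀ π : Equiv.Perm (Fin n), (∀ b ∈ B, π b = b) → ∀ M : PMSol n, g (π • M) = g M) :
    g ∈ polLE n k := by
  refine mem_polLE_of_junta B hB g fun M M' h => ?_
  obtain ⟨π, hπB, hπ⟩ := exists_perm_fix_smul_eq B M' M h
  rw [← hπ, hg π hπB]

end Literature.Combinatorics.Optimization
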